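import Mathlib

/-!
# `SnSubsetDichotomy.HyperoctahedralSubsets`, line `spherical-rank-sieve` — the GLOBAL HARVEST of twin pairs

Helper for crux `stmt-MatrixMultiplication-8305` (lead c1; memo `Cruxes/HyperoctahedralSubsets/LeadC1-PoorCore.md` §2).
Vocabulary of the line: `μ 0, μ 1, μ 2` are permutations of `Fin n` (the three perfect matchings), a BASED
CLOSED COLOUR-WALK of length `k + 2` is a pair `cp = (col, p)` with `col : Fin (k+2) → Fin 3` (the colour
word, read cyclically) and `p : Fin (k+2) → Fin n` with `μ (col i) (p i) = p (i + 1)` for all `i`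
(indices mod `k + 2`); it is SIMPLE if `p` is injective.  Two simple closed walks OF THE SAME COLOUR WORD
with disjoint point sets are a "twin pair", which carries a commuting local triple (the landed
`stub_cycleGadget` of the twin line); `G` twin pairs with pairwise disjoint point sets give `G`
support-disjoint local triples, the currency of the crux (`stub_triplesToGroup`, `stub_groupPacking`).

What this file proves (`stub_globalHarvest`): let `W` be any finite set of simple based closed walks of
length `k + 2` (arbitrary colour words), let every point of `Fin n` lie on at most `D ≥ 1` members of `W`,
and for a forbidden set `R` put

  `Φ(R) := Σ_{col} ( #{(col, p) ∈ W : p avoids R} − (k+2)² )`   (truncated subtraction, sum over the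
                                                                     colour words occurring in `W`).

If `2(k+2)·D·G ≤ Φ(R)` then there are `G` twin pairs from `W`, all point sets pairwise disjoint and
disjoint from `R`.  Proof: greedy with a potential.  While `Φ > 0` some colour word has more than
`(k+2)²` surviving walks; a simple closed walk of a fixed colour word is determined by any one of its
points (forward determination), so at most `(k+2)²` walks of that word meet a given one, hence two
surviving walks of that word are disjoint — a twin pair avoiding `R`; adding its `≤ 2(k+2)` points to `R`
lowers `Φ` by at most `2(k+2)·D` (each new forbidden point kills at most `D` walks, and truncated
subtraction is 1-Lipschitz).  The point of the lemma is that the accounting is GLOBAL over all colour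
words: the harvest threshold per word is `(k+2)²` — not `√n` — as soon as no vertex is dense (`D` small),
which is what reduces the open core of the line to MICRO-POOR hosts (memo §2).  [folklore / this line]
-/

-- the project's summit namespace `Summit.MatrixMultiplication.MatrixMultiplication` repeats a component by design (D-0022)
set_option linter.dupNamespace false

namespace Summit.MatrixMultiplication.MatrixMultiplication.Theorems.HyperoctahedralSubsets

open Equiv Equiv.Perm Finset

namespace GlobalHarvest

variable {n k : ℕ}

/-- **Forward determination.**  Two closed walks of the same colour word that agree at one position
agree everywhere. [folklore] -/
theorem walk_eq_of_apply_eq (μ : Fin 3 → Perm (Fin n)) (col : Fin (k + 2) → Fin 3)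
    {p q : Fin (k + 2) → Fin n} (hp : ∀ i, μ (col i) (p i) = p (i + 1))
    (hq : ∀ i, μ (col i) (q i) = q (i + 1)) {j : Fin (k + 2)} (h : p j = q j) : p = q := by
  have key : ∀ m : Fin (k + 2), p (j + m) = q (j + m) := by
    refine Fin.induction ?_ (fun i ih => ?_)
    · simpa using h
    · rw [← Fin.coeSucc_eq_succ, ← add_assoc, ← hp, ← hq, ih]
  funext i
  have := key (i - j)
  rwa [add_sub_cancel] at this

/-- At most `(k+2)²` closed walks of one colour word meet the point set of a given map
`p : Fin (k+2) → Fin n`. [folklore] -/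
theorem card_meet_le (μ : Fin 3 → Perm (Fin n)) (col : Fin (k + 2) → Fin 3)
    (P : Finset (Fin (k + 2) → Fin n)) (hP : ∀ q ∈ P, ∀ i, μ (col i) (q i) = q (i + 1))
    (p : Fin (k + 2) → Fin n) :
    (P.filter fun q => ∃ i i', q i' = p i).card ≤ (k + 2) * (k + 2) := by
  classical
  have hsub : (P.filter fun q => ∃ i i', q i' = p i) ⊆
      (univ : Finset (Fin (k + 2) × Fin (k + 2))).biUnion
        fun ii => P.filter fun q => q ii.2 = p ii.1 := by
    intro q hq
    rw [mem_filter] at hq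
    obtain ⟨hqP, i, i', hi⟩ := hq
    exact mem_biUnion.2 ⟨(i, i'), mem_univ _, mem_filter.2 ⟨hqP, hi⟩⟩
  refine (card_le_card hsub).trans ((card_biUnion_le).trans ?_)
  have hone : ∀ ii ∈ (univ : Finset (Fin (k + 2) × Fin (k + 2))),
      (P.filter fun q => q ii.2 = p ii.1).card ≤ 1 := by
    intro ii _
    refine card_le_one.2 fun a ha b hb => ?_
    rw [mem_filter] at ha hb
    exact walk_eq_of_apply_eq μ col (hP a ha.1) (hP b hb.1) (ha.2.trans hb.2.symm)
  calc ∑ ii ∈ (univ : Finset (Fin (k + 2) × Fin (k + 2))), (P.filter fun q => q ii.2 = p ii.1).card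
      ≤ ∑ _ii ∈ (univ : Finset (Fin (k + 2) × Fin (k + 2))), 1 := sum_le_sum hone
    _ = (k + 2) * (k + 2) := by simp

/-- **One twin pair from a crowded colour word.**  If more than `(k+2)²` simple closed walks of one
colour word avoid `R`, two of them have disjoint point sets. [folklore] -/
theorem exists_disjoint_pair (μ : Fin 3 → Perm (Fin n)) (col : Fin (k + 2) → Fin 3)
    (P : Finset (Fin (k + 2) → Fin n)) (hP : ∀ q ∈ P, ∀ i, μ (col i) (q i) = q (i + 1))
    (hcard : (k + 2) * (k + 2) < P.card) :
    ∃ p ∈ P, ∃ q ∈ P, ∀ i i', p i ≠ q i' := by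
  classical
  have hne : P.Nonempty := card_pos.1 (lt_of_le_of_lt (Nat.zero_le _) hcard)
  obtain ⟨p, hp⟩ := hne
  have hC := card_meet_le μ col P hP p
  obtain ⟨q, hqP, hq⟩ := exists_mem_notMem_of_card_lt_card
    (s := P.filter fun q => ∃ i i', q i' = p i) (t := P) (lt_of_le_of_lt hC hcard)
  refine ⟨p, hp, q, hqP, fun i i' h => hq (mem_filter.2 ⟨hqP, i, i', h.symm⟩)⟩

/-- **Potential drop.**  Forbidding the extra points `U` lowers the potential
`Φ(R) = Σ_col (#survivors − (k+2)²)` by at most `|U|·D`, where `D` bounds the number of members of `W`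
through any point. [this line] -/
theorem potential_drop (W : Finset ((Fin (k + 2) → Fin 3) × (Fin (k + 2) → Fin n))) (D : ℕ)
    (hD : ∀ v, (W.filter fun cp => ∃ i, cp.2 i = v).card ≤ D) (R U : Finset (Fin n)) :
    ∑ col ∈ W.image Prod.fst, ((W.filter fun cp => cp.1 = col ∧ ∀ i, cp.2 i ∉ R).card - (k + 2) ^ 2)
      ≤ ∑ col ∈ W.image Prod.fst,
          ((W.filter fun cp => cp.1 = col ∧ ∀ i, cp.2 i ∉ R ∪ U).card - (k + 2) ^ 2) +
        U.card * D := by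
  classical
  -- walks that touch `U`, and their fibres over the colour word
  set H : Finset ((Fin (k + 2) → Fin 3) × (Fin (k + 2) → Fin n)) :=
    W.filter fun cp => ∃ i, cp.2 i ∈ U with hH
  have hHW : ∀ cp ∈ H, cp.1 ∈ W.image Prod.fst := fun cp hcp =>
    mem_image.2 ⟨cp, (mem_filter.1 hcp).1, rfl⟩
  have hfib : H.card = ∑ col ∈ W.image Prod.fst, (H.filter fun cp => cp.1 = col).card :=
    card_eq_sum_card_fiberwise hHW
  -- `|H| ≤ |U|·D`
  have hHle : H.card ≤ U.card * D := by
    have hsub : H ⊆ U.biUnion fun v => W.filter fun cp => ∃ i, cp.2 i = v := by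
      intro cp hcp
      obtain ⟨hW, i, hi⟩ := mem_filter.1 hcp
      exact mem_biUnion.2 ⟨cp.2 i, hi, mem_filter.2 ⟨hW, i, rfl⟩⟩
    refine (card_le_card hsub).trans (card_biUnion_le.trans ?_)
    calc ∑ v ∈ U, (W.filter fun cp => ∃ i, cp.2 i = v).card ≤ ∑ _v ∈ U, D := sum_le_sum fun v _ => hD v
      _ = U.card * D := by rw [sum_const, smul_eq_mul]
  -- per colour word: survivors of `R` survive `R ∪ U` or touch `U`
  have hcol : ∀ col ∈ W.image Prod.fst,
      (W.filter fun cp => cp.1 = col ∧ ∀ i, cp.2 i ∉ R).card - (k + 2) ^ 2 ≤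
        ((W.filter fun cp => cp.1 = col ∧ ∀ i, cp.2 i ∉ R ∪ U).card - (k + 2) ^ 2) +
          (H.filter fun cp => cp.1 = col).card := by
    intro col _
    have hsub : (W.filter fun cp => cp.1 = col ∧ ∀ i, cp.2 i ∉ R) ⊆
        (W.filter fun cp => cp.1 = col ∧ ∀ i, cp.2 i ∉ R ∪ U) ∪ H.filter fun cp => cp.1 = col := by
      intro cp hcp
      obtain ⟨hW, hc, hR⟩ := mem_filter.1 hcp
      by_cases hU : ∃ i, cp.2 i ∈ U
      · exact mem_union_right _ (mem_filter.2 ⟨mem_filter.2 ⟨hW, hU⟩, hc⟩)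
      · have hU' : ∀ i, cp.2 i ∉ U := fun i hi => hU ⟨i, hi⟩
        refine mem_union_left _ (mem_filter.2 ⟨hW, hc, fun i => ?_⟩)
        rw [mem_union, not_or]
        exact ⟨hR i, hU' i⟩
    have h1 := (card_le_card hsub).trans (card_union_le _ _)
    omega
  calc ∑ col ∈ W.image Prod.fst, ((W.filter fun cp => cp.1 = col ∧ ∀ i, cp.2 i ∉ R).card - (k + 2) ^ 2)
      ≤ ∑ col ∈ W.image Prod.fst,
          (((W.filter fun cp => cp.1 = col ∧ ∀ i, cp.2 i ∉ R ∪ U).card - (k + 2) ^ 2) +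
            (H.filter fun cp => cp.1 = col).card) := sum_le_sum hcol
    _ = ∑ col ∈ W.image Prod.fst,
          ((W.filter fun cp => cp.1 = col ∧ ∀ i, cp.2 i ∉ R ∪ U).card - (k + 2) ^ 2) + H.card := by
        rw [sum_add_distrib, hfib]
    _ ≤ _ := by omega

end GlobalHarvest

open GlobalHarvest in
/-- **Global harvest of twin pairs** (crux `SnSubsetDichotomy.HyperoctahedralSubsets`,
stmt-MatrixMultiplication-8305, line `spherical-rank-sieve`; memo `LeadC1-PoorCore.md` §2).  Let `W` be a finite
set of SIMPLE based closed colour-walks of length `k + 2` for the permutations `μ 0, μ 1, μ 2` of `Fin n`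
(`cp = (col, p)`, `p` injective, `μ (col i) (p i) = p (i+1)` cyclically), let every point lie on at most
`D ≥ 1` members of `W`, and let `R` be a forbidden set with
`2(k+2)·D·G ≤ Φ(R) := Σ_{col ∈ W.image fst} (#{(col,p) ∈ W : p avoids R} − (k+2)²)`.
Then there are `G` TWIN PAIRS `(cols j; ps j, qs j)` — both `(cols j, ps j)` and `(cols j, qs j)` in `W`
(same colour word), with disjoint point sets — whose point sets are pairwise disjoint over `j` and
disjoint from `R`.  (Each twin pair carries a commuting local triple by the landed `stub_cycleGadget`
when the colour word is cyclically non-repeating; so `G` pairs give `G` support-disjoint local triples.)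
Proof: greedy induction on `G` with the potential `Φ` (`exists_disjoint_pair`, `potential_drop`).
[this line] -/
theorem stub_globalHarvest :
    ∀ (n k D : ℕ) (μ : Fin 3 → Equiv.Perm (Fin n))
      (W : Finset ((Fin (k + 2) → Fin 3) × (Fin (k + 2) → Fin n))),
      (∀ cp ∈ W, Function.Injective cp.2 ∧ ∀ i, μ (cp.1 i) (cp.2 i) = cp.2 (i + 1)) →
      0 < D → (∀ v, (W.filter fun cp => ∃ i, cp.2 i = v).card ≤ D) →
      ∀ (G : ℕ) (R : Finset (Fin n)),
        2 * (k + 2) * D * G ≤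
          ∑ col ∈ W.image Prod.fst,
            ((W.filter fun cp => cp.1 = col ∧ ∀ i, cp.2 i ∉ R).card - (k + 2) ^ 2) →
        ∃ (cols : Fin G → Fin (k + 2) → Fin 3) (ps qs : Fin G → Fin (k + 2) → Fin n),
          (∀ j, (cols j, ps j) ∈ W ∧ (cols j, qs j) ∈ W) ∧
          (∀ j i i', ps j i ≠ qs j i') ∧
          (∀ j j', j ≠ j' → ∀ i i',
            ps j i ≠ ps j' i' ∧ ps j i ≠ qs j' i' ∧ qs j i ≠ ps j' i' ∧ qs j i ≠ qs j' i') ∧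
          (∀ j i, ps j i ∉ R ∧ qs j i ∉ R) := by
  intro n k D μ W hW hD0 hD G
  classical
  induction G with
  | zero =>
    intro R _
    exact ⟨Fin.elim0, Fin.elim0, Fin.elim0, fun j => j.elim0, fun j => j.elim0, fun j => j.elim0,
      fun j => j.elim0⟩
  | succ G ih =>
    intro R hΦ
    -- abbreviations
    set Φ : Finset (Fin n) → ℕ := fun R =>
      ∑ col ∈ W.image Prod.fst,
        ((W.filter fun cp => cp.1 = col ∧ ∀ i, cp.2 i ∉ R).card - (k + 2) ^ 2) with hΦ_def
    have hΦR : 2 * (k + 2) * D * (G + 1) ≤ Φ R := hΦ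
    -- the potential is positive, so some colour word is crowded
    have hpos : 0 < Φ R := by
      have : 1 ≤ 2 * (k + 2) * D * (G + 1) := by
        have h1 : 1 ≤ 2 * (k + 2) * D := by nlinarith
        nlinarith
      omega
    obtain ⟨col, hcol, hcolpos⟩ := exists_ne_zero_of_sum_ne_zero (Nat.pos_iff_ne_zero.1 hpos)
    set S : Finset ((Fin (k + 2) → Fin 3) × (Fin (k + 2) → Fin n)) :=
      W.filter fun cp => cp.1 = col ∧ ∀ i, cp.2 i ∉ R with hS
    have hScard : (k + 2) * (k + 2) < S.card := by
      have : (k + 2) ^ 2 < S.card := by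
        by_contra h
        exact hcolpos (Nat.sub_eq_zero_of_le (not_lt.1 h))
      simpa [pow_two] using this
    -- the surviving walks of that word, as point maps
    set P : Finset (Fin (k + 2) → Fin n) := S.image Prod.snd with hP
    have hPmem : ∀ q ∈ P, (col, q) ∈ W ∧ ∀ i, q i ∉ R := by
      intro q hq
      obtain ⟨cp, hcp, rfl⟩ := mem_image.1 hq
      obtain ⟨hcpW, hc, hR⟩ := mem_filter.1 hcp
      have e : cp = (col, cp.2) := by rw [← hc]
      exact ⟨e ▸ hcpW, hR⟩
    have hPstep : ∀ q ∈ P, ∀ i, μ (col i) (q i) = q (i + 1) := fun q hq =>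
      (hW _ (hPmem q hq).1).2
    have hPcard : P.card = S.card := by
      refine card_image_of_injOn fun a ha b hb hab => ?_
      obtain ⟨_, hca, _⟩ := mem_filter.1 (mem_coe.1 ha)
      obtain ⟨_, hcb, _⟩ := mem_filter.1 (mem_coe.1 hb)
      exact Prod.ext (hca.trans hcb.symm) hab
    -- a twin pair of that word avoiding `R`
    obtain ⟨p, hp, q, hq, hpq⟩ :=
      exists_disjoint_pair μ col P hPstep (by rw [hPcard]; exact hScard)
    -- forbid its points and recurse
    set U : Finset (Fin n) := univ.image p ∪ univ.image q with hU
    have hUcard : U.card ≤ 2 * (k + 2) := by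
      refine (card_union_le _ _).trans ?_
      have h1 : (univ.image p).card ≤ k + 2 := by
        simpa using (card_image_le (s := (univ : Finset (Fin (k + 2)))) (f := p))
      have h2 : (univ.image q).card ≤ k + 2 := by
        simpa using (card_image_le (s := (univ : Finset (Fin (k + 2)))) (f := q))
      omega
    have hdrop := potential_drop W D hD R U
    have hΦR' : 2 * (k + 2) * D * G ≤ Φ (R ∪ U) := by
      have e1 : 2 * (k + 2) * D * (G + 1) = 2 * (k + 2) * D * G + 2 * (k + 2) * D := by ring
      have e2 : U.card * D ≤ 2 * (k + 2) * D := Nat.mul_le_mul_right _ hUcard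
      have h3 : Φ R ≤ Φ (R ∪ U) + U.card * D := hdrop
      omega
    obtain ⟨cols, ps, qs, hmem, hin, hcross, havoid⟩ := ih (R ∪ U) hΦR'
    -- points of `p`, `q` are in `U`; the recursive pairs avoid `U`
    have hpU : ∀ i, p i ∈ U := fun i => mem_union_left _ (mem_image.2 ⟨i, mem_univ _, rfl⟩)
    have hqU : ∀ i, q i ∈ U := fun i => mem_union_right _ (mem_image.2 ⟨i, mem_univ _, rfl⟩)
    have hpsU : ∀ j i, ps j i ∉ U := fun j i h => (havoid j i).1 (mem_union_right _ h)
    have hqsU : ∀ j i, qs j i ∉ U := fun j i h => (havoid j i).2 (mem_union_right _ h)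
    refine ⟨Fin.cons col cols, Fin.cons p ps, Fin.cons q qs, ?_, ?_, ?_, ?_⟩
    · refine Fin.cases ?_ (fun j => ?_)
      · simpa using ⟨(hPmem p hp).1, (hPmem q hq).1⟩
      · simpa using hmem j
    · refine Fin.cases ?_ (fun j => ?_)
      · simpa using hpq
      · simpa using hin j
    · refine Fin.cases ?_ (fun j => ?_) <;> refine Fin.cases ?_ (fun j' => ?_)
      · intro h; exact absurd rfl h
      · intro _ i i'
        simp only [Fin.cons_zero, Fin.cons_succ]
        exact ⟨fun h => hpsU j' i' (h ▸ hpU i), fun h => hqsU j' i' (h ▸ hpU i),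
          fun h => hpsU j' i' (h ▸ hqU i), fun h => hqsU j' i' (h ▸ hqU i)⟩
      · intro _ i i'
        simp only [Fin.cons_zero, Fin.cons_succ]
        exact ⟨fun h => hpsU j i (h.symm ▸ hpU i'), fun h => hpsU j i (h.symm ▸ hqU i'),
          fun h => hqsU j i (h.symm ▸ hpU i'), fun h => hqsU j i (h.symm ▸ hqU i')⟩
      · intro hjj' i i'
        simp only [Fin.cons_succ]
        exact hcross j j' (fun h => hjj' (by rw [h])) i i'
    · refine Fin.cases ?_ (fun j => ?_)
      · intro i
        simpa using ⟨(hPmem p hp).2 i, (hPmem q hq).2 i⟩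
      · intro i
        simp only [Fin.cons_succ]
        exact ⟨fun h => (havoid j i).1 (mem_union_left _ h),
          fun h => (havoid j i).2 (mem_union_left _ h)⟩

end Summit.MatrixMultiplication.MatrixMultiplication.Theorems.HyperoctahedralSubsets
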